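import Literature.Topology.FourManifolds.SphereProductSwapOrientation
import Literature.Topology.FourManifolds.PlumbingSphereGeometry
import Literature.Topology.FourManifolds.BordismFourOrientation
import Literature.AlgebraicTopology.SingularHomology.ChartTransitionLocalDegree
import Literature.AlgebraicTopology.SingularHomology.LocalHomologyVanishing
import Literature.AlgebraicTopology.SingularHomology.TripleSequence
import HarnessLib

/-!
# For `k` even the plumbing map preserves the local orientation at the crossing point

Topic `Literature/Topology/FourManifolds` (fact seat of
`Literature.Topology.FourManifolds.HomotopySphere.exists_intersectionForm_equivalent_e8Form`,
Kosinski's `E₈` plumbing `M(4m)`, *Differential Manifolds* (1993), VI.12). Two tubes of the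
diagonal of `Sᵏ × Sᵏ` are plumbed by the involution `plumbMap e` of
`PlumbingSphereGeometry.lean` — Kosinski's identification `(x, y) ↦ (y, x)` (VI.12 p. 120) — and
the coherence of the orientations of the eight pieces of `M(4n)` (which makes all eight
self-intersection numbers `+2`, VI.(12.4), and the form POSITIVE definite `E₈`) is the statement
that for `k` even this identification preserves orientation. We prove it in homological form,
at the crossing point `x₀ = (e, e)` (a fixed point of `plumbMap e`), for EVERY `ℤ`-orientation
`μ` of `Sᵏ × Sᵏ` and WITHOUT Jacobians: `plumbMap e = Λ⁻¹ ∘ σ ∘ Λ` where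
`Λ(p, q) = (p, rotTo p e q)` (the fibre point transported to the fibre over the pole) is a
homeomorphism near `x₀` fixing `x₀`, and `σ` is the swap, which preserves `μ` for `k` even
(`SphereProductSwapOrientation.lean`); the local signs of `Λ` and `Λ⁻¹` at `x₀` cancel.

* generic lemmas on pushing the excised local class `μₓ` of an open set `U ∋ x` forward along a
  map `F : U → X`: `map_subsetIncl_openSubsetIso_inv` (the inclusion gives back `μₓ`),
  `map_subsetIncl_localHomology_injective`, `map_openSubsetIso_inv_eq_or_eq_neg` (an open
  embedding gives `±μ_{F x}`), `isOpenEmbedding_restrict_of_leftInverse`;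
* `Plumbing.plumbFst_diag_pole`, `Plumbing.plumbMap_diag_pole` (`x₀` is fixed),
  `Plumbing.continuousOn_transportTo/From` (continuity of `Λ^{±1}` where `p ≠ -e`);
* **`Plumbing.map_plumbMap_openSubsetIso_inv_localClass`** — for `k ≥ 2` even, `-1 ≤ c < 1`
  and every `ℤ`-orientation `μ` of `Sᵏ × Sᵏ` in degree `n + 1 = 2k`: pushing the local class
  `μ_{x₀}`, excised to the plumbing domain `D_e(c)`, forward along `plumbMap e` gives `μ_{x₀}`.

Everything is proved; no definitions, no named facts (D-0026).

## References

* A. Kosinski, *Differential Manifolds*, Academic Press 1993, VI.12 p. 120, (12.3)–(12.4).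
  [Kosinski1993]
* A. Hatcher, *Algebraic Topology*, CUP 2002, §3.3 pp. 231–236 (local orientations, local
  homology is local). [HatcherAT2002]
-/

open scoped Manifold ContDiff Topology RealInnerProductSpace
open Set Function CategoryTheory CategoryTheory.Limits Topology

noncomputable section

namespace Literature.Topology.FourManifolds

open Literature.AlgebraicTopology.SingularHomology

/-! ### Generic lemmas: pushing an excised local class forward -/

section Generic

/-- An injective map sends the complement of `{y}` into the complement of `{q}` when
`f y = q` — duplicate of
`Literature.AlgebraicTopology.SingularHomology.mapsTo_compl_singleton_of_injective`
(`SingularHomology/LocalDegreeSign.lean`), kept as a deprecated alias (librarian dedup-01468).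
[folklore] -/
@[deprecated Literature.AlgebraicTopology.SingularHomology.mapsTo_compl_singleton_of_injective
  (since := "2026-08-16")]
alias mapsTo_compl_singleton_of_injective' :=
  Literature.AlgebraicTopology.SingularHomology.mapsTo_compl_singleton_of_injective

variable {X : Type} [TopologicalSpace X] [T1Space X] {N : ℕ}

/-- Pushing a class of `Hₙ(U | x)`, written as the excision of `a ∈ Hₙ(X | x)`, forward along
the inclusion `U ⊆ X` gives back `a` (Hatcher 2002, §3.3 p. 231: excision).
[cite: HatcherAT2002, §3.3 p. 231] -/
theorem map_subsetIncl_openSubsetIso_inv {U : Set X} (hU : IsOpen U) {x : X} (hx : x ∈ U)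
    (h : MapsTo (subsetIncl U) ({(⟨x, hx⟩ : ↥U)}ᶜ : Set ↥U) ({x}ᶜ : Set X))
    (a : localHomology ℤ ℤ X x N) :
    relativeSingularHomology.map ℤ ℤ (subsetIncl U) h N
        ((localHomology.openSubsetIso ℤ ℤ hU hx N).inv a) = a := by
  change ((localHomology.openSubsetIso ℤ ℤ hU hx N).inv ≫
    (localHomology.openSubsetIso ℤ ℤ hU hx N).hom) a = _
  rw [Iso.inv_hom_id]
  rfl

/-- The inclusion of an open set `U ∋ x` is injective on local homology `Hₙ(U | x) → Hₙ(X | x)`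
(it is the excision isomorphism). [cite: HatcherAT2002, §3.3 p. 231] -/
theorem map_subsetIncl_localHomology_injective {U : Set X} (hU : IsOpen U) {x : X} (hx : x ∈ U)
    (h : MapsTo (subsetIncl U) ({(⟨x, hx⟩ : ↥U)}ᶜ : Set ↥U) ({x}ᶜ : Set X)) :
    Injective (relativeSingularHomology.map ℤ ℤ (subsetIncl U) h N) := by
  change Injective (localHomology.openSubsetIso ℤ ℤ hU hx N).hom
  exact (localHomology.openSubsetIso ℤ ℤ hU hx N).toLinearEquiv.injective

/-- **An open embedding pushes the excised local class to `±` the local class at the image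
point**: for `F : U → X` an open embedding of an open `U ∋ x` with `F x = q`,
`F₊ (μₓ|U) = ±μ_q` (`F₊` is an isomorphism `Hₙ(U | x) ≅ Hₙ(X | q)`, Hatcher §3.3 p. 231, and a
generator of `Hₙ(X | q; ℤ) ≅ ℤ` is `±μ_q`). [cite: HatcherAT2002, §3.3 pp. 231–234] -/
theorem map_openSubsetIso_inv_eq_or_eq_neg (μ : HomologicalOrientation ℤ X N) {U : Set X}
    (hU : IsOpen U) {x : X} (hx : x ∈ U) (F : C(↥U, X)) (hF : IsOpenEmbedding F) {q : X}
    (hq : F ⟨x, hx⟩ = q) (h : MapsTo F ({(⟨x, hx⟩ : ↥U)}ᶜ : Set ↥U) ({q}ᶜ : Set X)) :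
    relativeSingularHomology.map ℤ ℤ F h N
        ((localHomology.openSubsetIso ℤ ℤ hU hx N).inv (μ.localClass x)) = μ.localClass q ∨
      relativeSingularHomology.map ℤ ℤ F h N
        ((localHomology.openSubsetIso ℤ ℤ hU hx N).inv (μ.localClass x)) = -μ.localClass q := by
  subst hq
  haveI := localHomology.isIso_map_of_isOpenEmbedding ℤ ℤ F hF ⟨x, hx⟩ h N
  apply eq_or_eq_neg_of_isGenerator
  · rw [exists_linearEquiv_apply_eq_one_iff_of_isIso]
    exact (exists_linearEquiv_apply_eq_one_iff_of_isIso
      (localHomology.openSubsetIso ℤ ℤ hU hx N).inv _).2 (μ.isGenerator x)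
  · exact μ.isGenerator (F ⟨x, hx⟩)

omit [T1Space X] in
/-- A local class is not `2`-torsion: `μₓ ≠ -μₓ` (it generates `Hₙ(X | x; ℤ) ≅ ℤ`).
[cite: HatcherAT2002, §3.3 p. 231] -/
theorem _root_.Literature.AlgebraicTopology.SingularHomology.HomologicalOrientation.localClass_ne_neg
    (μ : HomologicalOrientation ℤ X N) (x : X) :
    μ.localClass x ≠ -μ.localClass x := by
  obtain ⟨e, he⟩ := μ.isGenerator x
  intro h
  have := congrArg e h
  rw [map_neg, he] at this
  norm_num at this

omit [T1Space X] in
/-- **Restricting a map with a two-sided inverse (both continuous on an open set `G` mapped to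
itself) to an open `U ⊆ G` gives an open embedding `U → X`.** [folklore] -/
theorem isOpenEmbedding_restrict_of_leftInverse {f g : X → X} {G U : Set X} (hG : IsOpen G)
    (hU : IsOpen U) (hUG : U ⊆ G) (hf : ContinuousOn f G) (hg : ContinuousOn g G)
    (hfG : MapsTo f G G) (hgf : ∀ x, g (f x) = x) (hfg : ∀ x, f (g x) = x) :
    IsOpenEmbedding (fun x : ↥U => f x.1) := by
  refine IsOpenEmbedding.of_continuous_injective_isOpenMap ?_ ?_ ?_
  · exact hf.comp_continuous continuous_subtype_val fun x => hUG x.2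
  · intro a b hab
    apply Subtype.ext
    have := congrArg g hab
    simpa only [hgf] using this
  · intro W hW
    -- `f(W) = G ∩ g⁻¹(W)`
    have hW' : IsOpen (Subtype.val '' W : Set X) := hU.isOpenMap_subtype_val W hW
    have heq : (fun x : ↥U => f x.1) '' W = G ∩ g ⁻¹' (Subtype.val '' W) := by
      ext y
      constructor
      · rintro ⟨w, hw, rfl⟩
        exact ⟨hfG (hUG w.2), by rw [mem_preimage, hgf]; exact ⟨w, hw, rfl⟩⟩
      · rintro ⟨hyG, ⟨w, hw, hwy⟩⟩
        exact ⟨w, hw, by change f w.1 = y; rw [hwy, hfg]⟩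
    rw [heq]
    exact hg.isOpen_inter_preimage hG hW'

end Generic

/-! ### The plumbing map at the crossing point -/

namespace Plumbing

variable {k n : ℕ}

/-- The transported vector `rotFrom p e q` of unit vectors is a unit vector. [folklore] -/
theorem mem_sphere_rotFrom (p e q : Metric.sphere (0 : EuclideanSpace ℝ (Fin (k + 1))) 1) :
    rotFrom (p : EuclideanSpace ℝ (Fin (k + 1))) (e : EuclideanSpace ℝ (Fin (k + 1)))
      (q : EuclideanSpace ℝ (Fin (k + 1))) ∈ Metric.sphere (0 : EuclideanSpace ℝ (Fin (k + 1))) 1 := by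
  rw [mem_sphere_zero_iff_norm, norm_rotFrom, norm_eq_of_mem_sphere q]

/-- The crossing point lies in every plumbing domain `D_e(c)`, `c < 1`. [folklore] -/
theorem diag_pole_mem_plumbDom (e : Metric.sphere (0 : EuclideanSpace ℝ (Fin (k + 1))) 1) {c : ℝ}
    (hc : c < 1) : (e, e) ∈ plumbDom e c := by
  have h1 : ⟪(e : EuclideanSpace ℝ (Fin (k + 1))), (e : EuclideanSpace ℝ (Fin (k + 1)))⟫ = 1 := by
    rw [real_inner_self_eq_norm_sq, norm_eq_of_mem_sphere e, one_pow]
  refine ⟨?_, ?_⟩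
  · change c < ⟪(e : EuclideanSpace ℝ (Fin (k + 1))), (e : EuclideanSpace ℝ (Fin (k + 1)))⟫
    rw [h1]; exact hc
  · change c < ⟪(e : EuclideanSpace ℝ (Fin (k + 1))), (e : EuclideanSpace ℝ (Fin (k + 1)))⟫
    rw [h1]; exact hc

/-- `plumbFst e (e, e) = e` (`rotTo e e = id`). [folklore] -/
theorem plumbFst_diag_pole (e : Metric.sphere (0 : EuclideanSpace ℝ (Fin (k + 1))) 1) :
    plumbFst e (e, e) = e :=
  Subtype.ext (rotTo_self_self _)

/-- `rotFrom e e e = e`. [folklore] -/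
theorem rotFrom_pole_pole (e : Metric.sphere (0 : EuclideanSpace ℝ (Fin (k + 1))) 1) :
    rotFrom (e : EuclideanSpace ℝ (Fin (k + 1))) (e : EuclideanSpace ℝ (Fin (k + 1)))
      (e : EuclideanSpace ℝ (Fin (k + 1))) = e := by
  refine rotFrom_pole rfl ?_
  rw [← two_smul ℝ]
  exact smul_ne_zero two_ne_zero (coe_sphere_ne_zero e)

/-- **The crossing point `(e, e)` is a fixed point of the plumbing map.**
[cite: Kosinski1993, VI.12 p. 120] -/
theorem plumbMap_diag_pole (e : Metric.sphere (0 : EuclideanSpace ℝ (Fin (k + 1))) 1) :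
    plumbMap e (e, e) = (e, e) := by
  have h1 := plumbFst_diag_pole e
  refine Prod.ext h1 (Subtype.ext ?_)
  rw [plumbMap_snd, coe_plumbSnd, h1]
  exact rotFrom_pole_pole e

/-- **Continuity of the fibre transport `Λ(p, q) = (p, rotTo p e q)`** where `p ≠ -e`.
[folklore] -/
theorem continuousOn_transportTo (e : Metric.sphere (0 : EuclideanSpace ℝ (Fin (k + 1))) 1) :
    ContinuousOn (fun x : (Metric.sphere (0 : EuclideanSpace ℝ (Fin (k + 1))) 1) ×
        (Metric.sphere (0 : EuclideanSpace ℝ (Fin (k + 1))) 1) => (x.1, plumbFst e x))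
      {x | -1 < baseHt e x} := by
  intro x hx
  refine ContinuousWithinAt.prodMk continuous_fst.continuousWithinAt ?_
  have h := (contMDiffAt_coe_plumbFst e hx).continuousAt
  have h' : ContinuousAt (plumbFst e) x :=
    (Topology.IsInducing.subtypeVal.continuousAt_iff).2 h
  exact h'.continuousWithinAt

/-- **Continuity of the inverse fibre transport `Λ⁻¹(p, q) = (p, rotFrom p e q)`** where
`p ≠ -e`. [folklore] -/
theorem continuousOn_transportFrom (e : Metric.sphere (0 : EuclideanSpace ℝ (Fin (k + 1))) 1) :
    ContinuousOn (fun x : (Metric.sphere (0 : EuclideanSpace ℝ (Fin (k + 1))) 1) ×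
        (Metric.sphere (0 : EuclideanSpace ℝ (Fin (k + 1))) 1) =>
          (x.1, (⟨rotFrom (x.1 : EuclideanSpace ℝ (Fin (k + 1))) (e : EuclideanSpace ℝ (Fin (k + 1)))
            (x.2 : EuclideanSpace ℝ (Fin (k + 1))), mem_sphere_rotFrom x.1 e x.2⟩ :
            Metric.sphere (0 : EuclideanSpace ℝ (Fin (k + 1))) 1)))
      {x | -1 < baseHt e x} := by
  intro x hx
  refine ContinuousWithinAt.prodMk continuous_fst.continuousWithinAt ?_
  have h0 := add_ne_zero_of_neg_one_lt_inner (norm_eq_of_mem_sphere e) hx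
  have hg : ContDiffAt ℝ ∞ (fun z : EuclideanSpace ℝ (Fin (k + 1)) × EuclideanSpace ℝ (Fin (k + 1)) =>
      rotFrom z.1 (e : EuclideanSpace ℝ (Fin (k + 1))) z.2)
      ((x.1 : EuclideanSpace ℝ (Fin (k + 1))), (x.2 : EuclideanSpace ℝ (Fin (k + 1)))) :=
    contDiffAt_rotFrom contDiffAt_fst contDiffAt_const contDiffAt_snd h0 (coe_sphere_ne_zero e)
  have hc : ContinuousAt (fun y : (Metric.sphere (0 : EuclideanSpace ℝ (Fin (k + 1))) 1) ×
      (Metric.sphere (0 : EuclideanSpace ℝ (Fin (k + 1))) 1) =>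
        rotFrom (y.1 : EuclideanSpace ℝ (Fin (k + 1))) (e : EuclideanSpace ℝ (Fin (k + 1)))
          (y.2 : EuclideanSpace ℝ (Fin (k + 1)))) x := by
    have hcoe : Continuous (fun y : (Metric.sphere (0 : EuclideanSpace ℝ (Fin (k + 1))) 1) ×
        (Metric.sphere (0 : EuclideanSpace ℝ (Fin (k + 1))) 1) =>
          ((y.1 : EuclideanSpace ℝ (Fin (k + 1))), (y.2 : EuclideanSpace ℝ (Fin (k + 1))))) := by
      fun_prop
    exact ContinuousAt.comp (f := fun y : (Metric.sphere (0 : EuclideanSpace ℝ (Fin (k + 1))) 1) ×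
        (Metric.sphere (0 : EuclideanSpace ℝ (Fin (k + 1))) 1) =>
          ((y.1 : EuclideanSpace ℝ (Fin (k + 1))), (y.2 : EuclideanSpace ℝ (Fin (k + 1))))) (x := x)
      hg.continuousAt hcoe.continuousAt
  have h' := (Topology.IsInducing.subtypeVal.continuousAt_iff
    (f := fun y : (Metric.sphere (0 : EuclideanSpace ℝ (Fin (k + 1))) 1) ×
      (Metric.sphere (0 : EuclideanSpace ℝ (Fin (k + 1))) 1) =>
        (⟨rotFrom (y.1 : EuclideanSpace ℝ (Fin (k + 1))) (e : EuclideanSpace ℝ (Fin (k + 1)))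
          (y.2 : EuclideanSpace ℝ (Fin (k + 1))), mem_sphere_rotFrom y.1 e y.2⟩ :
          Metric.sphere (0 : EuclideanSpace ℝ (Fin (k + 1))) 1))).2 hc
  exact h'.continuousWithinAt

set_option maxHeartbeats 800000 in
/-- **For `k` even the plumbing map preserves the local orientation at the crossing point.**
Let `k ≥ 2` be even, `k + k = n + 1`, `μ` any `ℤ`-orientation of `Sᵏ × Sᵏ` in degree `n + 1`,
`e ∈ Sᵏ` a pole, `-1 ≤ c < 1`, `D = D_e(c)` the plumbing domain (an open set containing the
crossing point `x₀ = (e, e)`, mapped to itself by the plumbing involution `plumbMap e`, which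
fixes `x₀`), and `P : D → Sᵏ × Sᵏ` the (continuous) restriction of `plumbMap e`. Then pushing
the local class `μ_{x₀}`, excised to `D`, forward along `P` gives `μ_{x₀}` back:
`P₊ (μ_{x₀}|D) = μ_{x₀}` — Kosinski's identification `(x, y) ↦ (y, x)` of the two plumbed disc
bundles is orientation preserving for `k` even (VI.12 p. 120; this is why all the
self-intersections of `M(4n)` are `+2`, (12.4)). Proof without Jacobians: on `D`,
`plumbMap e = Λ⁻¹ ∘ σ ∘ Λ` with `Λ(p, q) = (p, rotTo p e q)` a homeomorphism near `x₀` fixing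
`x₀` (an open embedding of `D` by `isOpenEmbedding_restrict_of_leftInverse`, `G = {⟪p, e⟫ > -1}`)
and `σ` the swap; `t = (Λ|D)₊ (μ_{x₀}|D) = ±μ_{x₀}` (an open embedding pushes a local generator to a local
generator), `σ₊ t = t` because `σ₊ μ_{x₀} = μ_{x₀}` for `k` even
(`SphereProd.map_prodSwap_localClass'`), and `(Λ⁻¹|G)₊ (t|G) = μ_{x₀}` because `Λ⁻¹ ∘ Λ = id`.
[cite: Kosinski1993, VI.12 p. 120 and (12.4)] [cite: HatcherAT2002, §3.3 pp. 231–236] -/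
theorem map_plumbMap_openSubsetIso_inv_localClass (hk : 2 ≤ k) (hke : Even k)
    (hkn : k + k = n + 1)
    (μ : HomologicalOrientation ℤ ((Metric.sphere (0 : EuclideanSpace ℝ (Fin (k + 1))) 1) ×
      (Metric.sphere (0 : EuclideanSpace ℝ (Fin (k + 1))) 1)) (n + 1))
    (e : Metric.sphere (0 : EuclideanSpace ℝ (Fin (k + 1))) 1) {c : ℝ} (hc : -1 ≤ c) (hc1 : c < 1)
    (P : C(↥(plumbDom e c), (Metric.sphere (0 : EuclideanSpace ℝ (Fin (k + 1))) 1) ×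
      (Metric.sphere (0 : EuclideanSpace ℝ (Fin (k + 1))) 1)))
    (hP : ∀ x, P x = plumbMap e x.1)
    (h : MapsTo P ({(⟨(e, e), diag_pole_mem_plumbDom e hc1⟩ : ↥(plumbDom e c))}ᶜ : Set _)
      ({(e, e)}ᶜ : Set _)) :
    relativeSingularHomology.map ℤ ℤ P h (n + 1)
        ((localHomology.openSubsetIso ℤ ℤ (isOpen_plumbDom e c) (diag_pole_mem_plumbDom e hc1)
          (n + 1)).inv (μ.localClass (e, e))) = μ.localClass (e, e) := by
  -- notation
  set x₀ : (Metric.sphere (0 : EuclideanSpace ℝ (Fin (k + 1))) 1) ×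
    (Metric.sphere (0 : EuclideanSpace ℝ (Fin (k + 1))) 1) := (e, e) with hx₀
  have hx₀D : x₀ ∈ plumbDom e c := diag_pole_mem_plumbDom e hc1
  set G : Set ((Metric.sphere (0 : EuclideanSpace ℝ (Fin (k + 1))) 1) ×
    (Metric.sphere (0 : EuclideanSpace ℝ (Fin (k + 1))) 1)) := {x | -1 < baseHt e x} with hG
  have hGo : IsOpen G := isOpen_lt continuous_const (continuous_baseHt e)
  have hDG : plumbDom e c ⊆ G := fun x hx => lt_of_le_of_lt hc hx.1
  have hx₀G : x₀ ∈ G := hDG hx₀D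
  -- the fibre transports `Λ`, `Λ⁻¹`
  set Λ : (Metric.sphere (0 : EuclideanSpace ℝ (Fin (k + 1))) 1) ×
      (Metric.sphere (0 : EuclideanSpace ℝ (Fin (k + 1))) 1) →
      (Metric.sphere (0 : EuclideanSpace ℝ (Fin (k + 1))) 1) ×
        (Metric.sphere (0 : EuclideanSpace ℝ (Fin (k + 1))) 1) := fun x => (x.1, plumbFst e x) with hΛ
  set Λ' : (Metric.sphere (0 : EuclideanSpace ℝ (Fin (k + 1))) 1) ×
      (Metric.sphere (0 : EuclideanSpace ℝ (Fin (k + 1))) 1) →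
      (Metric.sphere (0 : EuclideanSpace ℝ (Fin (k + 1))) 1) ×
        (Metric.sphere (0 : EuclideanSpace ℝ (Fin (k + 1))) 1) := fun x =>
    (x.1, (⟨rotFrom (x.1 : EuclideanSpace ℝ (Fin (k + 1))) (e : EuclideanSpace ℝ (Fin (k + 1)))
      (x.2 : EuclideanSpace ℝ (Fin (k + 1))), mem_sphere_rotFrom x.1 e x.2⟩ :
      Metric.sphere (0 : EuclideanSpace ℝ (Fin (k + 1))) 1)) with hΛ'
  have hΛ'Λ : ∀ x, Λ' (Λ x) = x := fun x =>
    Prod.ext rfl (Subtype.ext (rotFrom_rotTo _ _ _))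
  have hΛΛ' : ∀ x, Λ (Λ' x) = x := fun x =>
    Prod.ext rfl (Subtype.ext (rotTo_rotFrom _ _ _))
  have hΛG : MapsTo Λ G G := fun x hx => hx
  have hΛ'G : MapsTo Λ' G G := fun x hx => hx
  have hΛc : ContinuousOn Λ G := continuousOn_transportTo e
  have hΛ'c : ContinuousOn Λ' G := continuousOn_transportFrom e
  have hΛx₀ : Λ x₀ = x₀ := Prod.ext rfl (plumbFst_diag_pole e)
  have hΛ'x₀ : Λ' x₀ = x₀ := Prod.ext rfl (Subtype.ext (rotFrom_pole_pole e))
  -- the conjugation `plumbMap e = Λ⁻¹ ∘ σ ∘ Λ`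
  have hconj : ∀ x, plumbMap e x = Λ' (Λ x).swap := fun x => Prod.ext rfl (Subtype.ext rfl)
  -- `σ (Λ x) ∈ G` for `x ∈ D`
  have hσΛG : ∀ x ∈ plumbDom e c, (Λ x).swap ∈ G := by
    intro x hx
    change -1 < baseHt e (plumbFst e x, x.1)
    rw [baseHt_apply, inner_plumbFst_pole e (lt_of_le_of_lt hc hx.1)]
    exact lt_of_le_of_lt hc hx.2
  -- the open embeddings `F₁ = Λ|D : D → X`, `F₃ = Λ⁻¹|G : G → X`, and `F₁' : D → G`, `j : D → G`
  have hF₁emb : IsOpenEmbedding (fun x : ↥(plumbDom e c) => Λ x.1) :=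
    isOpenEmbedding_restrict_of_leftInverse hGo (isOpen_plumbDom e c) hDG hΛc hΛ'c hΛG hΛ'Λ hΛΛ'
  have hF₃c : Continuous (fun x : ↥G => Λ' x.1) :=
    hΛ'c.comp_continuous continuous_subtype_val fun x => x.2
  set F₁ : C(↥(plumbDom e c), (Metric.sphere (0 : EuclideanSpace ℝ (Fin (k + 1))) 1) ×
      (Metric.sphere (0 : EuclideanSpace ℝ (Fin (k + 1))) 1)) := ⟨fun x => Λ x.1, hF₁emb.continuous⟩
    with hF₁
  set F₃ : C(↥G, (Metric.sphere (0 : EuclideanSpace ℝ (Fin (k + 1))) 1) ×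
      (Metric.sphere (0 : EuclideanSpace ℝ (Fin (k + 1))) 1)) := ⟨fun x => Λ' x.1, hF₃c⟩
    with hF₃
  set F₁' : C(↥(plumbDom e c), ↥G) := ⟨fun x => ⟨Λ x.1, hΛG (hDG x.2)⟩,
    hF₁emb.continuous.subtype_mk _⟩ with hF₁'
  set j : C(↥(plumbDom e c), ↥G) := ⟨fun x => ⟨(Λ x.1).swap, hσΛG x.1 x.2⟩,
    (continuous_swap.comp hF₁emb.continuous).subtype_mk _⟩ with hj
  -- base points and `MapsTo` data
  have hF₁x : F₁ ⟨x₀, hx₀D⟩ = x₀ := hΛx₀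
  have hF₃x : F₃ ⟨x₀, hx₀G⟩ = x₀ := hΛ'x₀
  have hF₁'x : F₁' ⟨x₀, hx₀D⟩ = ⟨x₀, hx₀G⟩ := Subtype.ext hΛx₀
  have hjx : j ⟨x₀, hx₀D⟩ = ⟨x₀, hx₀G⟩ := by
    apply Subtype.ext
    change (Λ x₀).swap = x₀
    rw [hΛx₀, hx₀]; rfl
  have m₁ : MapsTo F₁ ({(⟨x₀, hx₀D⟩ : ↥(plumbDom e c))}ᶜ : Set _) ({x₀}ᶜ : Set _) :=
    AlgebraicTopology.SingularHomology.mapsTo_compl_singleton_of_injective hF₁emb.injective hF₁x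
  have hF₃inj : Injective F₃ := by
    intro a b hab
    apply Subtype.ext
    have h1 : Λ (Λ' a.1) = Λ (Λ' b.1) := congrArg Λ hab
    rwa [hΛΛ', hΛΛ'] at h1
  have m₃ : MapsTo F₃ ({(⟨x₀, hx₀G⟩ : ↥G)}ᶜ : Set _) ({x₀}ᶜ : Set _) :=
    AlgebraicTopology.SingularHomology.mapsTo_compl_singleton_of_injective hF₃inj hF₃x
  have hF₁'inj : Injective F₁' := fun a b hab =>
    hF₁emb.injective (congrArg Subtype.val hab :)
  have hjinj : Injective j := by
    intro a b hab
    have h1 : (Λ a.1).swap = (Λ b.1).swap := congrArg Subtype.val hab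
    have h2 : Λ a.1 = Λ b.1 := by simpa using congrArg Prod.swap h1
    exact hF₁emb.injective h2
  have m₁' : MapsTo F₁' ({(⟨x₀, hx₀D⟩ : ↥(plumbDom e c))}ᶜ : Set _) ({(⟨x₀, hx₀G⟩ : ↥G)}ᶜ : Set _) :=
    AlgebraicTopology.SingularHomology.mapsTo_compl_singleton_of_injective hF₁'inj hF₁'x
  have mj : MapsTo j ({(⟨x₀, hx₀D⟩ : ↥(plumbDom e c))}ᶜ : Set _) ({(⟨x₀, hx₀G⟩ : ↥G)}ᶜ : Set _) :=
    AlgebraicTopology.SingularHomology.mapsTo_compl_singleton_of_injective hjinj hjx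
  have mvD : MapsTo (subsetIncl (plumbDom e c)) ({(⟨x₀, hx₀D⟩ : ↥(plumbDom e c))}ᶜ : Set _)
      ({x₀}ᶜ : Set _) :=
    AlgebraicTopology.SingularHomology.mapsTo_compl_singleton_of_injective Subtype.val_injective rfl
  have mvG : MapsTo (subsetIncl G) ({(⟨x₀, hx₀G⟩ : ↥G)}ᶜ : Set _) ({x₀}ᶜ : Set _) :=
    AlgebraicTopology.SingularHomology.mapsTo_compl_singleton_of_injective Subtype.val_injective rfl
  have mσ : MapsTo (ContinuousMap.prodSwap (α := Metric.sphere (0 : EuclideanSpace ℝ (Fin (k + 1))) 1)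
      (β := Metric.sphere (0 : EuclideanSpace ℝ (Fin (k + 1))) 1)) ({x₀}ᶜ : Set _) ({x₀}ᶜ : Set _) :=
    AlgebraicTopology.SingularHomology.mapsTo_compl_singleton_of_injective Prod.swap_injective rfl
  -- the excised class on `D`, and `t := Λ|D₊ (μ_{x₀}|D) = ±μ_{x₀}`
  set exD := (localHomology.openSubsetIso ℤ ℤ (isOpen_plumbDom e c) hx₀D (n + 1)).inv
    (μ.localClass x₀) with hexD
  have hvD : relativeSingularHomology.map ℤ ℤ (subsetIncl (plumbDom e c)) mvD (n + 1) exD =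
      μ.localClass x₀ := map_subsetIncl_openSubsetIso_inv _ hx₀D mvD _
  have hinjG := map_subsetIncl_localHomology_injective (N := n + 1) hGo hx₀G mvG
  set t := relativeSingularHomology.map ℤ ℤ F₁ m₁ (n + 1) exD with ht
  have htpm : t = μ.localClass x₀ ∨ t = -μ.localClass x₀ :=
    map_openSubsetIso_inv_eq_or_eq_neg μ (isOpen_plumbDom e c) hx₀D F₁ hF₁emb hF₁x m₁
  -- the swap fixes `μ_{x₀}` (`k` even), hence `t`
  have hσ : relativeSingularHomology.map ℤ ℤ (ContinuousMap.prodSwap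
      (α := Metric.sphere (0 : EuclideanSpace ℝ (Fin (k + 1))) 1)
      (β := Metric.sphere (0 : EuclideanSpace ℝ (Fin (k + 1))) 1)) mσ (n + 1) (μ.localClass x₀) =
      μ.localClass x₀ :=
    SphereProd.map_prodSwap_localClass' hk hke hkn μ x₀ x₀ rfl mσ
  have hσt : relativeSingularHomology.map ℤ ℤ (ContinuousMap.prodSwap
      (α := Metric.sphere (0 : EuclideanSpace ℝ (Fin (k + 1))) 1)
      (β := Metric.sphere (0 : EuclideanSpace ℝ (Fin (k + 1))) 1)) mσ (n + 1) t = t := by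
    rcases htpm with h1 | h1
    · rw [h1]; exact hσ
    · rw [h1, map_neg, hσ]
  -- `t` excised to `G`; `F₁'₊ exD = t|G` and `j₊ exD = t|G`
  set tG := (localHomology.openSubsetIso ℤ ℤ hGo hx₀G (n + 1)).inv t with htG
  have hvGt : relativeSingularHomology.map ℤ ℤ (subsetIncl G) mvG (n + 1) tG = t :=
    map_subsetIncl_openSubsetIso_inv hGo hx₀G mvG t
  have hF₁'ex : relativeSingularHomology.map ℤ ℤ F₁' m₁' (n + 1) exD = tG := by
    apply hinjG
    rw [hvGt, ht, ← ModuleCat.comp_apply, ← relativeSingularHomology.map_comp]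
    rfl
  have hjex : relativeSingularHomology.map ℤ ℤ j mj (n + 1) exD = tG := by
    apply hinjG
    have hcomp : (subsetIncl G).comp j = (ContinuousMap.prodSwap
        (α := Metric.sphere (0 : EuclideanSpace ℝ (Fin (k + 1))) 1)
        (β := Metric.sphere (0 : EuclideanSpace ℝ (Fin (k + 1))) 1)).comp F₁ := by
      ext x : 1; rfl
    rw [hvGt, ← ModuleCat.comp_apply, ← relativeSingularHomology.map_comp,
      relativeSingularHomology.map_congr ℤ ℤ hcomp (mvG.comp mj) (mσ.comp m₁) (n + 1),
      relativeSingularHomology.map_comp ℤ ℤ F₁ _ m₁ mσ (n + 1), ModuleCat.comp_apply, ← ht, hσt]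
  -- `Λ⁻¹ ∘ Λ = id` on `D`: `F₃₊ (t|G) = μ_{x₀}`
  have hF₃t : relativeSingularHomology.map ℤ ℤ F₃ m₃ (n + 1) tG = μ.localClass x₀ := by
    have hcomp : (subsetIncl (plumbDom e c) : C(↥(plumbDom e c), _)) = F₃.comp F₁' := by
      ext x : 1
      exact (hΛ'Λ x.1).symm
    rw [← hF₁'ex, ← ModuleCat.comp_apply, ← relativeSingularHomology.map_comp,
      ← relativeSingularHomology.map_congr ℤ ℤ hcomp mvD (m₃.comp m₁') (n + 1), hvD]
  -- conclusion: `P = F₃ ∘ j`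
  have hcomp : P = F₃.comp j := by
    ext x : 1
    rw [hP x]
    exact hconj x.1
  rw [relativeSingularHomology.map_congr ℤ ℤ hcomp h (m₃.comp mj) (n + 1),
    relativeSingularHomology.map_comp ℤ ℤ j F₃ mj m₃ (n + 1), ModuleCat.comp_apply, hjex, hF₃t]

end Plumbing

end Literature.Topology.FourManifolds
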